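import Mathlib
import Summits.KontsevichZagierPeriods.Zeta5Search.WedgeDictionaryOneTopKernel
import Summits.KontsevichZagierPeriods.Zeta5Search.WedgeDictionaryOneTopSteps
import Summits.KontsevichZagierPeriods.Zeta5Search.WedgeDictionaryOneTopValue
import Summits.KontsevichZagierPeriods.Zeta5Search.InvarianceGroup
import Literature.NumberTheory.Irrationality.BrownZudilin2022.CellularZetaFive
import HarnessLib

/-!
# The one-top datum `D2`: `I(1,0,1,0,1,1,0,1) = 2ζ(5) + 4ζ(2)ζ(3) − 5ζ(2) − 3/2` — the 5-fold assembly
# (cell `pub-zeta5`, seat ct-1 g21; item (3) of the wedge-dictionary programme; gen-1 g17 `LEVEL1-EXACT.md` Prop. B + Thm E)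

HONEST FRAMING: systematic search; no irrationality claim unless certified.  An exact EVALUATION of ONE of Brown–Zudilin's
absolutely convergent 5-fold cellular integrals [BrownZudilin2022, Sect. 1 (1)] — the level-1 one-top point
`a = (1,0,1,0,1,1,0,1)` (dual `(1; 0,0,0,0,0,0,1)`), whose value gen-1's wedge dictionary `explicitPQ` predicts as
`θ − 5ζ(2) − 3/2`, `θ = 2ζ(5) + 4ζ(3)ζ(2)` (`(Q, P̂, P) = (1, 5/4, 3/4)`).  With ct-1 g20's `explicitPQ_iff_oneTop`
(`WedgeDictionarySumRuleDatum`, staged) this value makes `explicitPQ` a theorem; THIS FILE proves the value only: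
**`cellularIntegral_oneTop : cellularIntegral ![1,0,1,0,1,1,0,1] = 2ζ(5) + 4ζ(2)ζ(3) − 5ζ(2) − 3/2`** (`ζ(k) = zetaValue k`).
Nothing about the irrationality of `ζ(5)`; no linear form; no `γ`; records in print unmoved.
Method (Tonelli through `MeasureTheory.lmarginal`, as in `WedgeDictionaryTopPairIntegral`; every one-variable step is a
lemma of `WedgeDictionaryOneTopKernel` / `WedgeDictionaryOneTopSteps`, all in `ℝ≥0∞` with non-negative integrands):
`t₁` (`lintegral_t1`), `t₅` (`lintegral_C`), `t₃` (`lintegral_t3`, the dilogarithm enters), then the substitution `t₂ = t₄·y`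
inside the `t₂`-integral (`lintegral_comp_mul_left_Ioo`) and a change of the peeling order, `t₄` (`lintegral_K`, the kernel
`M(y)`), and finally `y` (`WedgeDictionaryOneTopValue.integral_wM`).  Point / integrand / partial integrals are LOCAL NOTATIONS.
-/

noncomputable section

open MeasureTheory Set Filter Topology intervalIntegral
open scoped ENNReal

namespace Summit.KontsevichZagierPeriods.Zeta5Search.WedgeDictionaryOneTop

open Literature.Analysis.SpecialFunctions (reDilog continuous_reDilog)
open Literature.NumberTheory.Transcendental (zetaValue)
open Literature.NumberTheory.Irrationality.BrownZudilin2022 (integrand cellularIntegral openSimplex b24 b14 b57 b35 b36)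
open Summit.KontsevichZagierPeriods.Zeta5Search.InvarianceGroup (measurableSet_openSimplex')

/-! ## 1. The point, its integrand, and the chain of partially integrated functions -/

/-- The one-top point `a = (1,0,1,0,1,1,0,1)` (dual coordinates `(1; 0,0,0,0,0,0,1)`; local notation). -/
local notation "aB" => (![1, 0, 1, 0, 1, 1, 0, 1] : Fin 8 → ℤ)

/-- The integrand of (1) at `a` as a rational function (`t 0, …, t 4` for `t₁, …, t₅`):
`t₁(t₃−t₂)(t₅−t₄)(1−t₅)/((t₃−t₁)² t₃ (1−t₄)² (t₄−t₂)(t₅−t₂)²)` (local notation). -/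
local notation "fB" => (fun t : Fin 5 → ℝ =>
  t 0 * (t 2 - t 1) * (t 4 - t 3) * (1 - t 4) / ((t 2 - t 0) * (1 - t 3) * (t 4 - t 1)) /
    ((t 2 - t 0) * t 2 * (1 - t 3) * (t 3 - t 1) * (t 4 - t 1)))

/-- The integrand of (1) at `a` IS `fB`. [folklore] -/
theorem integrand_aB (t : Fin 5 → ℝ) : integrand aB t = fB t := by
  unfold integrand
  rw [show b24 aB = 1 by decide, show b14 aB = 0 by decide, show b57 aB = 1 by decide, show b35 aB = 0 by decide,
    show b36 aB = 1 by decide]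
  simp

/-- `fB` is measurable. [folklore] -/
theorem measurable_fB : Measurable fB := by fun_prop
/-- The extended integrand: `fB` on the open simplex, `0` outside, valued in `ℝ≥0∞` (local notation). -/
local notation "FB" => (Set.indicator openSimplex (fun t : Fin 5 → ℝ => ENNReal.ofReal (fB t)))

/-- `FB` is measurable. [folklore] -/
theorem measurable_FB : Measurable FB :=
  (ENNReal.measurable_ofReal.comp measurable_fB).indicator measurableSet_openSimplex'

/-- After the `t₁`-integration (local notation). -/
local notation "GB1" => (fun x : Fin 5 → ℝ =>
  ite (0 < x 1 ∧ x 1 < x 2 ∧ x 2 < x 3 ∧ x 3 < x 4 ∧ x 4 < 1)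
    (ENNReal.ofReal ((x 1 + (x 2 - x 1) * Real.log ((x 2 - x 1) / x 2)) * ((x 4 - x 3) * (1 - x 4)) /
      (x 2 * (1 - x 3) ^ 2 * (x 3 - x 1) * (x 4 - x 1) ^ 2)))
    (0 : ENNReal))

/-- After the `t₅`-integration (local notation). -/
local notation "GB2" => (fun x : Fin 5 → ℝ =>
  ite (0 < x 1 ∧ x 1 < x 2 ∧ x 2 < x 3 ∧ x 3 < 1)
    (ENNReal.ofReal ((x 1 + (x 2 - x 1) * Real.log ((x 2 - x 1) / x 2)) / x 2 *
      (((1 + x 3 - 2 * x 1) * Real.log ((1 - x 1) / (x 3 - x 1)) - 2 * (1 - x 3)) / ((1 - x 3) ^ 2 * (x 3 - x 1)))))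
    (0 : ENNReal))

/-- After the `t₃`-integration (local notation). -/
local notation "GB3" => (fun x : Fin 5 → ℝ =>
  ite (0 < x 1 ∧ x 1 < x 3 ∧ x 3 < 1)
    (ENNReal.ofReal ((x 1 * (Real.pi ^ 2 / 6 - reDilog (x 1 / x 3)) + (x 3 - x 1) * Real.log ((x 3 - x 1) / x 3)) *
      (((1 + x 3 - 2 * x 1) * Real.log ((1 - x 1) / (x 3 - x 1)) - 2 * (1 - x 3)) / ((1 - x 3) ^ 2 * (x 3 - x 1)))))
    (0 : ENNReal))

/-- After the substitution `t₂ = t₄·y` (coordinate `1` now carries `y`; local notation). -/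
local notation "GB4" => (fun x : Fin 5 → ℝ =>
  ite ((0 < x 1 ∧ x 1 < 1) ∧ 0 < x 3 ∧ x 3 < 1)
    (ENNReal.ofReal ((x 1 * (Real.pi ^ 2 / 6 - reDilog (x 1)) + (1 - x 1) * Real.log (1 - x 1)) / (1 - x 1) *
      (x 3 * ((1 + x 3 - 2 * (x 3 * x 1)) * Real.log ((1 - x 3 * x 1) / (x 3 * (1 - x 1))) - 2 * (1 - x 3)) / (1 - x 3) ^ 2)))
    (0 : ENNReal))

/-- After the `t₄`-integration: `w(y)·M(y)` on `0 < y < 1` (local notation). -/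
local notation "GB5" => (fun x : Fin 5 → ℝ =>
  ite (0 < x 1 ∧ x 1 < 1)
    (ENNReal.ofReal ((x 1 * (Real.pi ^ 2 / 6 - reDilog (x 1)) + (1 - x 1) * Real.log (1 - x 1)) / (1 - x 1) *
      (-(1 - 2 * x 1) * Real.log (1 - x 1) / x 1 - (3 - 4 * x 1) * (Real.pi ^ 2 / 6 + reDilog (x 1) + Real.log (1 - x 1) ^ 2 / 2)
        + 4 + 2 * Real.log (1 - x 1))))
    (0 : ENNReal))

/-- `GB1` is measurable. [folklore] -/
theorem measurable_GB1 : Measurable GB1 := by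
  refine Measurable.ite ?_ (by fun_prop) measurable_const
  measurability

/-- `GB2` is measurable. [folklore] -/
theorem measurable_GB2 : Measurable GB2 := by
  refine Measurable.ite ?_ (by fun_prop) measurable_const
  measurability

/-- `GB3` is measurable. [folklore] -/
theorem measurable_GB3 : Measurable GB3 := by
  have h : Continuous reDilog := continuous_reDilog
  refine Measurable.ite ?_ (by fun_prop) measurable_const
  measurability

/-- `GB4` is measurable. [folklore] -/
theorem measurable_GB4 : Measurable GB4 := by
  have h : Continuous reDilog := continuous_reDilog
  refine Measurable.ite ?_ (by fun_prop) measurable_const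
  measurability

/-! ## 2. The one-variable steps -/

/-- Step 0 (`t₁ ∈ (0, t₂)`, kernel `t₁/(t₃−t₁)²`). [folklore] -/
theorem step0 (x : Fin 5 → ℝ) : ∫⁻ s, FB (Function.update x 0 s) = GB1 x := by
  obtain ⟨h10, h20, h30, h40⟩ : (1 : Fin 5) ≠ 0 ∧ (2 : Fin 5) ≠ 0 ∧ (3 : Fin 5) ≠ 0 ∧ (4 : Fin 5) ≠ 0 := by decide
  by_cases hC : 0 < x 1 ∧ x 1 < x 2 ∧ x 2 < x 3 ∧ x 3 < x 4 ∧ x 4 < 1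
  · obtain ⟨h1, h12, h23, h34, h4⟩ := hC
    obtain ⟨d21, d43, d4, d2⟩ : 0 < x 2 - x 1 ∧ 0 < x 4 - x 3 ∧ 0 < 1 - x 4 ∧ 0 < x 2 :=
      ⟨by linarith, by linarith, by linarith, by linarith⟩
    obtain ⟨d3, d31, d41⟩ : 0 < 1 - x 3 ∧ 0 < x 3 - x 1 ∧ 0 < x 4 - x 1 := ⟨by linarith, by linarith, by linarith⟩
    set K : ℝ := (x 2 - x 1) * (x 4 - x 3) * (1 - x 4) / (x 2 * (1 - x 3) ^ 2 * (x 3 - x 1) * (x 4 - x 1) ^ 2) with hKdef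
    have hK : 0 ≤ K := by positivity
    have hfun : (fun s => FB (Function.update x 0 s)) =
        (Ioo 0 (x 1)).indicator (fun s => ENNReal.ofReal (K * (s / (x 2 - s) ^ 2))) := by
      funext s
      simp only [Set.indicator_apply, openSimplex, Set.mem_setOf_eq, Set.mem_Ioo,
        Function.update_self, Function.update_of_ne h10, Function.update_of_ne h20,
        Function.update_of_ne h30, Function.update_of_ne h40]
      by_cases hs : 0 < s ∧ s < x 1
      · rw [if_pos ⟨hs.1, hs.2, h12, h23, h34, h4⟩, if_pos hs]
        congr 1
        have hs2 : x 2 - s ≠ 0 := by linarith [hs.2]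
        rw [hKdef]
        field_simp
      · rw [if_neg (fun h => hs ⟨h.1, h.2.1⟩), if_neg hs]
    rw [hfun, lintegral_indicator measurableSet_Ioo, lintegral_t1 h1 h12 hK]
    simp only [if_pos (⟨h1, h12, h23, h34, h4⟩ : 0 < x 1 ∧ x 1 < x 2 ∧ x 2 < x 3 ∧ x 3 < x 4 ∧ x 4 < 1)]
    congr 1
    rw [hKdef]
    generalize Real.log ((x 2 - x 1) / x 2) = L
    field_simp
  · have hfun : (fun s => FB (Function.update x 0 s)) = fun _ => 0 := by
      funext s
      simp only [Set.indicator_apply, openSimplex, Set.mem_setOf_eq,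
        Function.update_self, Function.update_of_ne h10, Function.update_of_ne h20,
        Function.update_of_ne h30, Function.update_of_ne h40]
      rw [if_neg]
      intro h
      exact hC ⟨h.1.trans h.2.1, h.2.2⟩
    rw [hfun, lintegral_zero]; simp only [if_neg hC]

/-- Step 1 (`t₅ ∈ (t₄, 1)`, kernel `(t₅−t₄)(1−t₅)/(t₅−t₂)²`). [folklore] -/
theorem step1 (x : Fin 5 → ℝ) : ∫⁻ s, GB1 (Function.update x 4 s) = GB2 x := by
  obtain ⟨h14, h24, h34⟩ : (1 : Fin 5) ≠ 4 ∧ (2 : Fin 5) ≠ 4 ∧ (3 : Fin 5) ≠ 4 := by decide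
  by_cases hC : 0 < x 1 ∧ x 1 < x 2 ∧ x 2 < x 3 ∧ x 3 < 1
  · obtain ⟨h1, h12, h23, h3⟩ := hC
    obtain ⟨d21, d2, d3, d31⟩ : 0 < x 2 - x 1 ∧ 0 < x 2 ∧ 0 < 1 - x 3 ∧ 0 < x 3 - x 1 :=
      ⟨by linarith, by linarith, by linarith, by linarith⟩
    have h13 : x 1 < x 3 := h12.trans h23
    have hN : 0 ≤ x 1 + (x 2 - x 1) * Real.log ((x 2 - x 1) / x 2) := t1_nonneg' h1 h12
    set K : ℝ := (x 1 + (x 2 - x 1) * Real.log ((x 2 - x 1) / x 2)) / (x 2 * (1 - x 3) ^ 2 * (x 3 - x 1)) with hKdef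
    have hK : 0 ≤ K := by positivity
    have hfun : (fun s => GB1 (Function.update x 4 s)) =
        (Ioo (x 3) 1).indicator (fun s => ENNReal.ofReal (K * ((s - x 3) * (1 - s) / (s - x 1) ^ 2))) := by
      funext s
      simp only [Set.indicator_apply, Set.mem_Ioo, Function.update_self, Function.update_of_ne h14,
        Function.update_of_ne h24, Function.update_of_ne h34]
      by_cases hs : x 3 < s ∧ s < 1
      · rw [if_pos ⟨h1, h12, h23, hs.1, hs.2⟩, if_pos hs]
        congr 1
        have hs1 : s - x 1 ≠ 0 := by linarith [hs.1]
        rw [hKdef]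
        generalize Real.log ((x 2 - x 1) / x 2) = L
        field_simp
      · rw [if_neg (fun h => hs ⟨h.2.2.2.1, h.2.2.2.2⟩), if_neg hs]
    rw [hfun, lintegral_indicator measurableSet_Ioo, lintegral_C h13 h3 hK]
    · simp only [if_pos (⟨h1, h12, h23, h3⟩ : 0 < x 1 ∧ x 1 < x 2 ∧ x 2 < x 3 ∧ x 3 < 1)]
      congr 1
      rw [hKdef]
      generalize Real.log ((x 2 - x 1) / x 2) = L
      generalize Real.log ((1 - x 1) / (x 3 - x 1)) = L'
      field_simp
  · have hfun : (fun s => GB1 (Function.update x 4 s)) = fun _ => 0 := by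
      funext s
      simp only [Function.update_self, Function.update_of_ne h14, Function.update_of_ne h24,
        Function.update_of_ne h34]
      rw [if_neg]
      intro h
      exact hC ⟨h.1, h.2.1, h.2.2.1, h.2.2.2.1.trans h.2.2.2.2⟩
    rw [hfun, lintegral_zero]; simp only [if_neg hC]

/-- Step 2 (`t₃ ∈ (t₂, t₄)`, kernel `[t₂ + (t₃−t₂)log((t₃−t₂)/t₃)]/t₃` — the dilogarithm enters). [folklore] -/
theorem step2 (x : Fin 5 → ℝ) : ∫⁻ s, GB2 (Function.update x 2 s) = GB3 x := by
  obtain ⟨h12, h32⟩ : (1 : Fin 5) ≠ 2 ∧ (3 : Fin 5) ≠ 2 := by decide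
  by_cases hC : 0 < x 1 ∧ x 1 < x 3 ∧ x 3 < 1
  · obtain ⟨h1, h13, h3⟩ := hC
    obtain ⟨d3, d31⟩ : 0 < 1 - x 3 ∧ 0 < x 3 - x 1 := ⟨by linarith, by linarith⟩
    have hCn := C_nonneg (a := x 3) (b := x 1) h13 h3
    set K : ℝ := ((1 + x 3 - 2 * x 1) * Real.log ((1 - x 1) / (x 3 - x 1)) - 2 * (1 - x 3)) /
      ((1 - x 3) ^ 2 * (x 3 - x 1)) with hKdef
    have hK : 0 ≤ K := by positivity
    have hfun : (fun s => GB2 (Function.update x 2 s)) =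
        (Ioo (x 1) (x 3)).indicator (fun s => ENNReal.ofReal (K * ((x 1 + (s - x 1) * Real.log ((s - x 1) / s)) / s))) := by
      funext s
      simp only [Set.indicator_apply, Set.mem_Ioo, Function.update_self, Function.update_of_ne h12,
        Function.update_of_ne h32]
      by_cases hs : x 1 < s ∧ s < x 3
      · rw [if_pos ⟨h1, hs.1, hs.2, h3⟩, if_pos hs]
        congr 1
        rw [hKdef]
        ring
      · rw [if_neg (fun h => hs ⟨h.2.1, h.2.2.1⟩), if_neg hs]
    rw [hfun, lintegral_indicator measurableSet_Ioo, lintegral_t3 h1 h13 hK]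
    simp only [if_pos (⟨h1, h13, h3⟩ : 0 < x 1 ∧ x 1 < x 3 ∧ x 3 < 1)]
    congr 1
    rw [hKdef]
    ring
  · have hfun : (fun s => GB2 (Function.update x 2 s)) = fun _ => 0 := by
      funext s
      simp only [Function.update_self, Function.update_of_ne h12, Function.update_of_ne h32]
      rw [if_neg]
      intro h
      exact hC ⟨h.1, h.2.1.trans h.2.2.1, h.2.2.2⟩
    rw [hfun, lintegral_zero]; simp only [if_neg hC]

/-- Step 3: the substitution `t₂ = t₄·y` in the `t₂`-integral (coordinate `1`), for every value of the other coordinates.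
[folklore] -/
theorem step3 (x : Fin 5 → ℝ) : ∫⁻ s, GB3 (Function.update x 1 s) = ∫⁻ s, GB4 (Function.update x 1 s) := by
  have h31 : (3 : Fin 5) ≠ 1 := by decide
  by_cases hC : 0 < x 3 ∧ x 3 < 1
  · obtain ⟨h3, h3'⟩ := hC
    have hfun3 : (fun s => GB3 (Function.update x 1 s)) = (Ioo 0 (x 3)).indicator (fun s => ENNReal.ofReal
        ((s * (Real.pi ^ 2 / 6 - reDilog (s / x 3)) + (x 3 - s) * Real.log ((x 3 - s) / x 3)) *
          (((1 + x 3 - 2 * s) * Real.log ((1 - s) / (x 3 - s)) - 2 * (1 - x 3)) / ((1 - x 3) ^ 2 * (x 3 - s))))) := by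
      funext s
      simp only [Set.indicator_apply, Set.mem_Ioo, Function.update_self, Function.update_of_ne h31]
      by_cases hs : 0 < s ∧ s < x 3
      · rw [if_pos ⟨hs.1, hs.2, h3'⟩, if_pos hs]
      · rw [if_neg (fun h => hs ⟨h.1, h.2.1⟩), if_neg hs]
    have hfun4 : (fun s => GB4 (Function.update x 1 s)) = (Ioo (0:ℝ) 1).indicator (fun s => ENNReal.ofReal
        ((s * (Real.pi ^ 2 / 6 - reDilog s) + (1 - s) * Real.log (1 - s)) / (1 - s) *
          (x 3 * ((1 + x 3 - 2 * (x 3 * s)) * Real.log ((1 - x 3 * s) / (x 3 * (1 - s))) - 2 * (1 - x 3)) /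
            (1 - x 3) ^ 2))) := by
      funext s
      simp only [Set.indicator_apply, Set.mem_Ioo, Function.update_self, Function.update_of_ne h31]
      by_cases hs : 0 < s ∧ s < 1
      · rw [if_pos ⟨hs, h3, h3'⟩, if_pos hs]
      · rw [if_neg (fun h => hs h.1), if_neg hs]
    rw [hfun3, hfun4, lintegral_indicator measurableSet_Ioo, lintegral_indicator measurableSet_Ioo,
      lintegral_comp_mul_left_Ioo h3]
    refine setLIntegral_congr_fun measurableSet_Ioo fun u hu => ?_
    have hu0 : u ≠ 0 := hu.1.ne'
    have hu1 : 1 - u ≠ 0 := by linarith [hu.2]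
    have hx : x 3 ≠ 0 := h3.ne'
    rw [← ENNReal.ofReal_mul h3.le]
    congr 1
    rw [show x 3 * u / x 3 = u by field_simp, show (x 3 - x 3 * u) / x 3 = 1 - u by field_simp,
      show (1 - x 3 * u) / (x 3 - x 3 * u) = (1 - x 3 * u) / (x 3 * (1 - u)) by ring]
    generalize reDilog u = R
    generalize Real.log (1 - u) = L1
    generalize Real.log ((1 - x 3 * u) / (x 3 * (1 - u))) = L2
    field_simp
  · have hfun3 : (fun s => GB3 (Function.update x 1 s)) = fun _ => 0 := by
      funext s
      simp only [Function.update_self, Function.update_of_ne h31]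
      rw [if_neg]
      intro h
      exact hC ⟨h.1.trans h.2.1, h.2.2⟩
    have hfun4 : (fun s => GB4 (Function.update x 1 s)) = fun _ => 0 := by
      funext s
      simp only [Function.update_self, Function.update_of_ne h31]
      rw [if_neg]
      intro h
      exact hC h.2
    rw [hfun3, hfun4]

/-- The weight `w(y) = [y(π²/6 − Li₂(y)) + (1−y)log(1−y)]/(1−y)` is non-negative on `(0,1)` (it is the value of the
`t₃`-step at `a = 1`). [folklore] -/
theorem w_nonneg {y : ℝ} (h0 : 0 < y) (h1 : y < 1) :
    0 ≤ (y * (Real.pi ^ 2 / 6 - reDilog y) + (1 - y) * Real.log (1 - y)) / (1 - y) := by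
  have h := t3_nonneg h0 h1
  rw [div_one, div_one] at h
  exact div_nonneg h (by linarith)

/-- Step 4 (`t₄ ∈ (0,1)`: the kernel `M(y)` of `WedgeDictionaryOneTopKernel`). [folklore] -/
theorem step4 (x : Fin 5 → ℝ) : ∫⁻ s, GB4 (Function.update x 3 s) = GB5 x := by
  have h13 : (1 : Fin 5) ≠ 3 := by decide
  by_cases hC : 0 < x 1 ∧ x 1 < 1
  · obtain ⟨h1, h1'⟩ := hC
    have hw := w_nonneg h1 h1'
    have hfun : (fun s => GB4 (Function.update x 3 s)) = (Ioo (0:ℝ) 1).indicator (fun s => ENNReal.ofReal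
        ((x 1 * (Real.pi ^ 2 / 6 - reDilog (x 1)) + (1 - x 1) * Real.log (1 - x 1)) / (1 - x 1) *
          (s * ((1 + s - 2 * (s * x 1)) * Real.log ((1 - s * x 1) / (s * (1 - x 1))) - 2 * (1 - s)) / (1 - s) ^ 2))) := by
      funext s
      simp only [Set.indicator_apply, Set.mem_Ioo, Function.update_self, Function.update_of_ne h13]
      by_cases hs : 0 < s ∧ s < 1
      · rw [if_pos ⟨⟨h1, h1'⟩, hs.1, hs.2⟩, if_pos hs]
      · rw [if_neg (fun h => hs h.2), if_neg hs]
    rw [hfun, lintegral_indicator measurableSet_Ioo, lintegral_K h1 h1' hw]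
    simp only [if_pos (⟨h1, h1'⟩ : 0 < x 1 ∧ x 1 < 1)]
  · have hfun : (fun s => GB4 (Function.update x 3 s)) = fun _ => 0 := by
      funext s
      simp only [Function.update_self, Function.update_of_ne h13]
      rw [if_neg]
      intro h
      exact hC h.1
    rw [hfun, lintegral_zero]; simp only [if_neg hC]

/-- Step 5 (`y ∈ (0,1)`: the last integration, `WedgeDictionaryOneTopValue.integral_wM`). [folklore] -/
theorem step5 (x : Fin 5 → ℝ) : ∫⁻ s, GB5 (Function.update x 1 s) =
    ENNReal.ofReal (2 * zetaValue 5 + 4 * zetaValue 2 * zetaValue 3 - 5 * zetaValue 2 - 3 / 2) := by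
  have hfun : (fun s => GB5 (Function.update x 1 s)) = (Ioo (0:ℝ) 1).indicator (fun s => ENNReal.ofReal
      ((s * (Real.pi ^ 2 / 6 - reDilog s) + (1 - s) * Real.log (1 - s)) / (1 - s) *
        (-(1 - 2 * s) * Real.log (1 - s) / s - (3 - 4 * s) * (Real.pi ^ 2 / 6 + reDilog s + Real.log (1 - s) ^ 2 / 2)
          + 4 + 2 * Real.log (1 - s)))) := by
    funext s
    simp only [Set.indicator_apply, Set.mem_Ioo, Function.update_self]
  obtain ⟨hI, hv⟩ := integral_wM
  have hnn : 0 ≤ᵐ[volume.restrict (Ioo (0:ℝ) 1)] fun s : ℝ =>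
      (s * (Real.pi ^ 2 / 6 - reDilog s) + (1 - s) * Real.log (1 - s)) / (1 - s) *
        (-(1 - 2 * s) * Real.log (1 - s) / s - (3 - 4 * s) * (Real.pi ^ 2 / 6 + reDilog s + Real.log (1 - s) ^ 2 / 2)
          + 4 + 2 * Real.log (1 - s)) :=
    (ae_restrict_mem measurableSet_Ioo).mono fun s hs => mul_nonneg (w_nonneg hs.1 hs.2) (M_nonneg hs.1 hs.2)
  rw [hfun, lintegral_indicator measurableSet_Ioo, ← ofReal_integral_eq_lintegral_ofReal hI hnn, hv]

/-! ## 3. Assembly: Tonelli through `lmarginal`, and the value of the cellular integral -/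

/-- One peeling step of the iterated integral (as in `WedgeDictionaryTopPairIntegral.peel`). [folklore] -/
private theorem peel' {s : Finset (Fin 5)} {i : Fin 5} (hi : i ∉ s) {f g : (Fin 5 → ℝ) → ENNReal} (hf : Measurable f)
    (h : ∀ x, ∫⁻ t, f (Function.update x i t) = g x) (x : Fin 5 → ℝ) :
    lmarginal (fun _ : Fin 5 => (volume : Measure ℝ)) (insert i s) f x =
      lmarginal (fun _ : Fin 5 => (volume : Measure ℝ)) s g x := by
  rw [lmarginal_insert' f hf hi]
  have e : (fun y => ∫⁻ t, f (Function.update y i t) ∂((fun _ : Fin 5 => (volume : Measure ℝ)) i)) = g :=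
    funext h
  rw [e]

/-- The value `V = 2ζ(5) + 4ζ(2)ζ(3) − 5ζ(2) − 3/2` is non-negative (it is `∫ w·M` with `w, M ≥ 0`). [folklore] -/
theorem value_nonneg : 0 ≤ 2 * zetaValue 5 + 4 * zetaValue 2 * zetaValue 3 - 5 * zetaValue 2 - 3 / 2 := by
  rw [← integral_wM.2]
  exact setIntegral_nonneg measurableSet_Ioo fun s hs => mul_nonneg (w_nonneg hs.1 hs.2) (M_nonneg hs.1 hs.2)

/-- `∫ FB = V` over `ℝ⁵` (Tonelli; coordinates integrated in the order `t₁, t₅, t₃`, then the substitution `t₂ = t₄ y`,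
then `t₄`, then `y`). [folklore] -/
theorem lintegral_FB : ∫⁻ t, FB t =
    ENNReal.ofReal (2 * zetaValue 5 + 4 * zetaValue 2 * zetaValue 3 - 5 * zetaValue 2 - 3 / 2) := by
  rw [MeasureTheory.volume_pi, lintegral_eq_lmarginal_univ (fun _ : Fin 5 => (0 : ℝ))]
  rw [show (Finset.univ : Finset (Fin 5)) = insert 0 {1, 2, 3, 4} from by decide,
    peel' (by decide) measurable_FB step0,
    show ({1, 2, 3, 4} : Finset (Fin 5)) = insert 4 {1, 2, 3} from by decide,
    peel' (by decide) measurable_GB1 step1,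
    show ({1, 2, 3} : Finset (Fin 5)) = insert 2 {1, 3} from by decide,
    peel' (by decide) measurable_GB2 step2,
    lmarginal_insert' _ measurable_GB3 (by decide : (1 : Fin 5) ∉ ({3} : Finset (Fin 5)))]
  simp_rw [step3]
  rw [← lmarginal_insert' _ measurable_GB4 (by decide : (1 : Fin 5) ∉ ({3} : Finset (Fin 5))),
    show ({1, 3} : Finset (Fin 5)) = insert 3 {1} from by decide,
    peel' (by decide) measurable_GB4 step4, lmarginal_singleton]
  exact step5 _

/-- `fB ≥ 0` on the open simplex. [folklore] -/
theorem fB_nonneg {t : Fin 5 → ℝ} (ht : t ∈ openSimplex) : 0 ≤ fB t := by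
  obtain ⟨h0, h01, h12, h23, h34, h4⟩ := ht
  obtain ⟨d21, d43, d4, d20⟩ : 0 < t 2 - t 1 ∧ 0 < t 4 - t 3 ∧ 0 < 1 - t 4 ∧ 0 < t 2 - t 0 :=
    ⟨by linarith, by linarith, by linarith, by linarith⟩
  obtain ⟨d3, d41, d2, d31⟩ : 0 < 1 - t 3 ∧ 0 < t 4 - t 1 ∧ 0 < t 2 ∧ 0 < t 3 - t 1 :=
    ⟨by linarith, by linarith, by linarith, by linarith⟩
  beta_reduce
  positivity

/-- **The one-top datum `D2`: `I(1,0,1,0,1,1,0,1) = 2ζ(5) + 4ζ(2)ζ(3) − 5ζ(2) − 3/2`** (`= θ − 5ζ(2) − 3/2`,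
`θ = 2ζ(5) + 4ζ(3)ζ(2)`) — the 5-fold cellular integral (1) of Brown–Zudilin at the level-1 one-top point, exactly
(gen-1 g17 `LEVEL1-EXACT.md` Prop. B + Thm E; the value gen-1's wedge dictionary `explicitPQ` predicts there,
`(Q, P̂, P) = (1, 5/4, 3/4)`). [folklore] -/
theorem cellularIntegral_oneTop : cellularIntegral ![1, 0, 1, 0, 1, 1, 0, 1] =
    2 * zetaValue 5 + 4 * zetaValue 2 * zetaValue 3 - 5 * zetaValue 2 - 3 / 2 := by
  show cellularIntegral aB = _
  unfold cellularIntegral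
  simp_rw [integrand_aB]
  rw [integral_eq_lintegral_of_nonneg_ae (ae_restrict_of_forall_mem measurableSet_openSimplex' fun t ht => fB_nonneg ht)
    measurable_fB.aestronglyMeasurable, ← lintegral_indicator measurableSet_openSimplex']
  rw [show (∫⁻ t, openSimplex.indicator (fun t => ENNReal.ofReal (fB t)) t) = _ from lintegral_FB,
    ENNReal.toReal_ofReal value_nonneg]

end Summit.KontsevichZagierPeriods.Zeta5Search.WedgeDictionaryOneTop
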